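/-
Copyright (c) 2026. All rights reserved.
Released under Apache 2.0 license as described in the file LICENSE.
Authors: abc-iut cell — seat abc-iut-f-140 (block F fact-proving wave; FACT-LIST row F-2772).
-/
import Literature.AnabelianGeometry.SemiGraphs.TemperedReconstructionR3Sub
import Literature.AnabelianGeometry.SemiGraphs.TrivialLoopChart
import HarnessLib

/-!
# The universal closure of the schema (R3c) `EdgeLikeCentralizerAt ℋ c` is FALSE: the loop of trivial
# anabelioids, whose tempered fundamental group is the discrete infinite cyclic group

Mochizuki, *Semi-graphs of anabelioids*, Publ. RIMS **42** (2006), §3: p. 33 (`B^temp(Π)`, Def. 3.1 (i)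
tempered groups), p. 36 (`B^cov(G)`), Def. 3.5 (i)(ii) p. 37 (coverings, tempered coverings), p. 38 /
Prop. 3.6 (ii) (`B^temp(π₁^temp(G)) ⥲ B^temp(G)`), Thm. 3.7 (i)/(iii) pp. 40–41 (verticial / edge-like
subgroups), Cor. 3.9, proof p. 43 l. 13 "[again by Theorem 3.7, (iii), (iv)]" — the step the cell names
(R3c) `EdgeLikeCentralizerAt` (`TemperedReconstructionR3Sub.lean`, FACT-LIST row F-2772; its `∀`-form over the
Cor-3.9 graphs is F-2773 `EdgeLikeCentralizer`) [cite: MochizukiSemiAnbd2006, Cor 3.9 p.43].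

WITNESS file (abc-iut cell, block F, seat abc-iut-f-140; KEYED row F2772).  The row F-2772 is a SCHEMA over
`(ℋ, c)` (a graph of anabelioids in the local presentation, a chart of its tempered fundamental group) with NO
hypothesis on `ℋ`.  Its instance forms at the Cor-3.9 graphs the cone consumes are in the tree (finite graphs
`edgeLikeCentralizerAt_of_finiteGraph`; locally finite / tame / no-core / topologically-cyclic / saturated /
finite-hostable classes, abc-iut-f-172 / f-176), the bare `∀` over Cor-3.9 graphs (F-2773) is conditional, and
the witness tables record "no ¬∀ witness known".  This PROOF-ONLY file (0 defs) gives the kernel verdict on the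
UNIVERSAL CLOSURE, at the object of the companion definitions file `TrivialLoopChart.lean`: the loop of TRIVIAL
anabelioids `trivialLoop` (`Π_v = Π_e = 1`) with its explicit chart `trivialLoopChart`, **`π₁^temp = ℤ`**
(discrete; `B^temp(trivialLoop) ≌ B^temp(ℤ)`, a covering being a countable set with its monodromy permutation):

* `isVerticialHom_one` / `isEdgeHom_one` — for that chart `equiv.inverse ⋙ ι ⋙ restrictV/E = BTemp.res 1`
  definitionally, so the trivial homomorphism `1 → ℤ` is a verticial and an edge homomorphism;
  `bot_mem_verticialSubgroups` — `⊥` is a verticial subgroup; `map_ι₀_le_bot` — every edge piece `ψ(U)` is `⊥`;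
* **`not_edgeLikeCentralizerAt_trivialLoop : ¬ EdgeLikeCentralizerAt trivialLoop trivialLoopChart`** — the
  centraliser of `ψ(U) = ⊥` is all of the (abelian) group `ℤ ⊄ ⊥`;
* the record: `exists_not_edgeLikeCentralizerAt`, **`not_forall_edgeLikeCentralizerAt :
  ¬ ∀ (ℋ : ProfiniteSemiGraph.{0}) (c : TemperedPiChart ℋ), EdgeLikeCentralizerAt ℋ c`** (type ≡ `¬` universal
  closure of the row's declaration at universe `0`, as for F-1710 `not_cor39`).

HONEST FRAMING.  REFUTED-AS-TYPED ≠ refuted-in-print: `trivialLoop` is NOT a Cor-3.9 object (a trivial edge group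
is neither aloof nor elevated as typed; print's (R3c) lives under "totally elevated", which makes every open
`U ⊆ Π_e` infinite); the witness says that the schema F-2772 carries content only through its INSTANCE FORMS
under `Cor39Hypotheses` and that total elevation cannot be dropped from (R3c); F-2773 is untouched.  Theorems
only; no statement of the paper is retyped, no `Prop` fact is named.  A FACT row is an assumption label on OUR
typed statement; typed ≠ proved; nothing here takes a side on [IUTchIII] Cor. 3.12.
-/

open CategoryTheory

namespace Literature.AnabelianGeometry.SemiGraphs

namespace ProfiniteSemiGraph

open IncoherentBouquet (loop)

namespace TrivialLoop

/-! ### The trivial homomorphism is verticial and edge-like; its image is `⊥` -/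

/-- The trivial homomorphism `1 → ℤ` is a verticial homomorphism of the explicit chart.
[cite: MochizukiSemiAnbd2006, Thm 3.7(i) p.40] -/
theorem isVerticialHom_one (v : loop.Vertex) : IsVerticialHom trivialLoopChart v ι₀ :=
  ⟨eqToIso (inverse_comp_restrictV v)⟩

/-- The trivial homomorphism `1 → ℤ` is an edge homomorphism of the explicit chart.
[cite: MochizukiSemiAnbd2006, Thm 3.7(iii) p.41] -/
theorem isEdgeHom_one (e : loop.Edge) : IsEdgeHom trivialLoopChart e ι₀ :=
  ⟨eqToIso (inverse_comp_restrictE e)⟩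

/-- The image of the trivial homomorphism `1 → ℤ` is the trivial subgroup. [cite: MochizukiSemiAnbd2006, Thm 3.7(i) p.40] -/
theorem range_ι₀ : ι₀.toMonoidHom.range = ⊥ :=
  (Subgroup.eq_bot_iff_forall _).mpr fun _ ⟨_, h⟩ => h ▸ rfl

/-- **The trivial subgroup is a verticial subgroup** of `π₁^temp(trivialLoop) = ℤ` (indeed the only one:
verticial homomorphisms out of `Π_v = 1`). [cite: MochizukiSemiAnbd2006, Thm 3.7(i) p.40] -/
theorem bot_mem_verticialSubgroups (v : loop.Vertex) :
    (⊥ : Subgroup Z) ∈ verticialSubgroups trivialLoopChart v :=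
  ⟨ι₀, isVerticialHom_one v, range_ι₀.symm⟩

/-- The image of any subgroup of `Π_e = 1` under the edge homomorphism is trivial.
[cite: MochizukiSemiAnbd2006, Thm 3.7(iii) p.41] -/
theorem map_ι₀_le_bot (U : Subgroup PUnit.{1}) : U.map ι₀.toMonoidHom ≤ (⊥ : Subgroup Z) :=
  (Subgroup.map_le_range _ U).trans range_ι₀.le

/-! ### The refutation -/

/-- **(R3c) `EdgeLikeCentralizerAt` FAILS at the loop of trivial anabelioids with its explicit chart**: the open
piece `ψ(U)` of the (trivial) edge group is `⊥`, the verticial subgroup `⊥` contains it, and the centraliser of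
`⊥` is all of `ℤ ⊄ ⊥`.  (Refuted-AS-TYPED: the object violates the hypotheses of Cor. 3.9 — a trivial edge
group is neither aloof nor elevated — so this says nothing against print's (R3c), whose standing hypothesis
"totally elevated" makes every open `U ⊆ Π_e` infinite; it says the schema carries content only through its
instance forms under `Cor39Hypotheses`.) [cite: MochizukiSemiAnbd2006, Cor 3.9 p.43] -/
theorem not_edgeLikeCentralizerAt_trivialLoop : ¬ EdgeLikeCentralizerAt trivialLoop trivialLoopChart := by
  intro h
  have hU : IsOpen (((⊤ : Subgroup PUnit.{1}) : Set PUnit.{1})) := isOpen_discrete _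
  have hle : Subgroup.centralizer (((⊤ : Subgroup PUnit.{1}).map ι₀.toMonoidHom : Subgroup Z) : Set Z) ≤
      (⊥ : Subgroup Z) :=
    h () ι₀ (isEdgeHom_one ()) ⊤ hU () ⊥ (bot_mem_verticialSubgroups ()) (map_ι₀_le_bot ⊤)
  -- the generator of `ℤ` centralises everything (the group is abelian) but is not trivial
  have hmem : Multiplicative.ofAdd (1 : ℤ) ∈
      Subgroup.centralizer (((⊤ : Subgroup PUnit.{1}).map ι₀.toMonoidHom : Subgroup Z) : Set Z) :=
    Subgroup.mem_centralizer_iff.mpr fun g _ => mul_comm g _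
  have h1 : Multiplicative.ofAdd (1 : ℤ) = 1 := Subgroup.mem_bot.mp (hle hmem)
  exact one_ne_zero (Multiplicative.ofAdd.injective h1)

/-- **There is a graph of anabelioids with a chart of its tempered fundamental group at which (R3c)
`EdgeLikeCentralizerAt` fails.** [cite: MochizukiSemiAnbd2006, Cor 3.9 p.43] -/
theorem exists_not_edgeLikeCentralizerAt :
    ∃ (ℋ : ProfiniteSemiGraph.{0}) (c : TemperedPiChart ℋ), ¬ EdgeLikeCentralizerAt ℋ c :=
  ⟨trivialLoop, trivialLoopChart, not_edgeLikeCentralizerAt_trivialLoop⟩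

/-- **The universal closure of the FACT-LIST schema F-2772 `EdgeLikeCentralizerAt` is FALSE** (at universe
`0`; witness: the loop of trivial anabelioids with `π₁^temp = ℤ`).  REFUTED-AS-TYPED: the instance forms under
`Cor39Hypotheses` (finite / locally finite / tame / no-core / topologically-cyclic / saturated / … Cor-3.9
graphs) are the row's content and are in the tree; F-2773 (the `∀` over Cor-3.9 graphs) is not touched.
[cite: MochizukiSemiAnbd2006, Cor 3.9 p.43] -/
theorem not_forall_edgeLikeCentralizerAt :
    ¬ ∀ (ℋ : ProfiniteSemiGraph.{0}) (c : TemperedPiChart ℋ), EdgeLikeCentralizerAt ℋ c :=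
  fun h => not_edgeLikeCentralizerAt_trivialLoop (h trivialLoop trivialLoopChart)

end TrivialLoop

end ProfiniteSemiGraph

end Literature.AnabelianGeometry.SemiGraphs
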